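import Summits.HodgeConjecture.CorCM.GaloisSkewSectionPrime
import Summits.HodgeConjecture.CorCM.GaloisSectionCountOrbits
import HarnessLib

/-!
# A NON-NORMAL SUBGROUP OF PRIME ORDER yields a SKEW CM set — the REFINED COUNT (orbits of the prime-order elements)

COR-CM (cell `pub-hodgecm2`), binder seat b04 (gen 39), count-neutral own lane «Galois-CM-type classification».  KERNEL ONLY,
Mathlib only: theorems; no definition, no named fact, no `sorry`.  Refinement of `CorCM/GaloisSkewSectionPrime` (gen 33) through
`CorCM/GaloisSectionCountOrbits` (gen 39).

SETTING (as in gen 33).  `G` finite, `c ∈ Z(G)` an involution, `u` of PRIME order `p`, `c ∉ U = ⟨u⟩`, `U` not normal with `m`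
conjugates; `H = ⟨u, c⟩ ≅ C_{2p}`, `P = G/H`, `n = |P| = |G|/(2p)`, `s = n/m = [N(U) : H]`.  The section sets `T_ε` (`ε : P → Bool`)
are CM sets with `T_ε u = T_ε`, and `v·T_ε = T_ε` forces the affine system `ε(v·q) = ε(q) ⊻ τ_v(q)`.  Gen 33 bounded the number of
solutions by `2^((n + f_v)/2)` for every `v ≠ 1` (`f_v` = fixed points of trivial twist: `0` unless `v` lies in a conjugate of `U`,
then `≤ s`), giving the count `|G|·2^(n/2) + m(p-1)·2^((n + n/m)/2) < 2^n`.

THE REFINEMENT.  (i) The `m(p-1)` non-trivial elements of the conjugates of `U` are EXACTLY those charged with the second term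
(distinct conjugates of a prime-order subgroup meet trivially), so the first term only needs `|G| - 1 - m(p-1)` elements.  (ii) Such
a `v` has order `p`, so the permutation `q ↦ v·q` of `P` has cycles of length exactly `p` off its `≤ s` fixed points, and its system
has at most `2^((n + (p-1)s)/p)` solutions (`SectionCount.card_filter_twisted_le_cycle`).  NEW COUNT:

  **`(|G| - 1 - m(p-1))·2^(n/2) + m(p-1)·2^((n + (p-1)(n/m))/p) < 2^n` for every `m ≥ m₀` dividing `n` ⟹ a skew CM set.**

It is implied by the old count (`CorCM/GaloisSkewCountPrimeOrbits`), and strictly stronger: the exact thresholds «all `m ≥ 2`» drop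
from `|G| ≥ 52, 84, 170, 238` to `|G| ≥ 44, 78, 150, 210` for `p = 2, 3, 5, 7` (and `n ≥ 17` instead of `21` for `p = 11, 13`); in
particular `n = 16` now passes for `p = 5` and `p = 7`, i.e. the degrees `160` and `224` — the two exceptions of gen 38's
degree-`32·p` structure theorem (`CorCM/GaloisThirtyTwoTimesPrimeStructure`).

* **`exists_skew_of_prime_order_family'`** — family form (`m₀` exhibited conjugators), refined count.
* **`exists_skew_of_nonnormal_prime_order'`** — `m₀ = 2` (`⟨u⟩` not normal), refined count.

## References

* [Shimura1998] G. Shimura, *Abelian Varieties with Complex Multiplication and Modular Functions*, §8.2 Prop. 26, §32.10.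
* [Kubota1965] T. Kubota, *On the field extension by complex multiplication*, Trans. AMS 118 (1965), §2 (context only).
-/

namespace Summit.HodgeConjecture.CorCM.GaloisModels.SkewSectionPrime

open Finset
variable {G : Type*} [Group G] [DecidableEq G] [Fintype G]

omit [DecidableEq G] [Fintype G] in
/-- In a group action, `g ^ p = 1` with `p` prime and `g ^ j • q = q` for some `0 < j < p` force `g • q = q`. [folklore] -/
theorem smul_eq_self_of_pow_smul_eq_self {β : Type*} [MulAction G β] {g : G} {q : β} {p j : ℕ} (hp : p.Prime)
    (hgp : g ^ p = 1) (hj : 0 < j) (hjp : j < p) (h : g ^ j • q = q) : g • q = q := by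
  haveI := Fact.mk hp
  by_cases hg1 : g = 1
  · rw [hg1, one_smul]
  have hord : orderOf g = p := orderOf_eq_prime hgp hg1
  have hcop : j.Coprime (orderOf g) := by rw [hord]; exact (Nat.coprime_of_lt_prime (by omega) hjp hp).symm
  obtain ⟨k, hk⟩ := exists_pow_eq_self_of_coprime hcop
  have hfix : ∀ i : ℕ, (g ^ j) ^ i • q = q := by
    intro i
    induction i with
    | zero => rw [pow_zero, one_smul]
    | succ i ih => rw [pow_succ, mul_smul, h, ih]
  rw [← hk]; exact hfix k

/-! ## §3' The skew section under the refined count -/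

/-- **A NON-NORMAL SUBGROUP OF PRIME ORDER YIELDS A SKEW CM SET** (family form, REFINED count).  `c` a central involution, `u` of
prime order `p` with `c ∉ ⟨u⟩`, `|G| = 2pn`; `g : Fin m₀ → G` conjugating `⟨u⟩` to `m₀` pairwise distinct subgroups; and
`(|G| - 1 - m(p-1))·2^(n/2) + m(p-1)·2^((n + (p-1)(n/m))/p) < 2^n` for every `m ≥ m₀` dividing `n`.  Then some `T ⊆ G` has
`x ∈ T ↔ cx ∉ T`, trivial left stabiliser, and `T u = T`. [folklore] -/
theorem exists_skew_of_prime_order_family' (c u : G) (p n m₀ : ℕ) [hp : Fact p.Prime]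
    (hcc : c * c = 1) (hcen : ∀ g : G, c * g = g * c) (hup : u ^ p = 1) (hu1 : u ≠ 1)
    (hcU : ∀ j < p, c ≠ u ^ j) (hcard : Fintype.card G = 2 * p * n)
    (g : Fin m₀ → G) (hind : ∀ i j : Fin m₀, i < j → ∀ k < p, ((g j)⁻¹ * g i) * u * ((g j)⁻¹ * g i)⁻¹ ≠ u ^ k)
    (hcount : ∀ m, m₀ ≤ m → m ∣ n →
      (Fintype.card G - 1 - m * (p - 1)) * 2 ^ (n / 2) + m * (p - 1) * 2 ^ ((n + (p - 1) * (n / m)) / p) < 2 ^ n) :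
    ∃ T : Finset G, (∀ x, x ∈ T ↔ c * x ∉ T) ∧ (∀ v : G, v ≠ 1 → ∃ w, ¬ (w ∈ T ↔ v * w ∈ T)) ∧
      (∀ x, x * u ∈ T ↔ x ∈ T) := by
  classical
  -- §3.1 arithmetic in `⟨u, c⟩`
  have hpos : 0 < p := hp.out.pos
  have hc1 : c ≠ 1 := fun h => hcU 0 hpos (by rw [pow_zero]; exact h)
  have hord : orderOf u = p := orderOf_eq_prime hup hu1
  have hcu : c * u = u * c := hcen u
  have hmod : ∀ k, u ^ (k % p) = u ^ k := fun k => by rw [← hord]; exact pow_mod_orderOf u k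
  have hcomm : ∀ j : ℕ, c * u ^ j = u ^ j * c := fun j => ((show Commute c u from hcu).pow_right j).eq
  have hexcl : ∀ i j : ℕ, u ^ i ≠ c * u ^ j := pow_ne_mul_pow hup hu1 hcU
  -- §3.2 the subgroup `H = ⟨u, c⟩ = {u^j, c u^j}` and its size `2p`
  set H : Subgroup G := Subgroup.closure ({u, c} : Set G) with hHdef
  have hH : ∀ x, x ∈ H ↔ ∃ j < p, (x = u ^ j ∨ x = c * u ^ j) := mem_closure_pair_iff_of_pow_eq_one hpos hcc hup hcu
  have huH : u ∈ H := Subgroup.subset_closure (by simp)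
  have hcH : c ∈ H := Subgroup.subset_closure (by simp)
  have hHcomm : ∀ w, w ∈ H → Commute w u := by
    intro w hw
    obtain ⟨j, -, rfl | rfl⟩ := (hH w).1 hw
    · exact Commute.pow_left (Commute.refl u) j
    · exact Commute.mul_left hcu (Commute.pow_left (Commute.refl u) j)
  have hHu : ∀ w, w ∈ H → ∀ i : ℕ, w * u ^ i * w⁻¹ = u ^ i := fun w hw i => by
    rw [((hHcomm w hw).pow_right i).eq, mul_inv_cancel_right]
  have hHcard : Nat.card H = 2 * p := card_closure_pair c u p hcc hup hu1 hcu hcU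
  -- §3.3 the coset space
  haveI : Fintype (G ⧸ H) := Fintype.ofFinite _
  have hGP : Nat.card G = Nat.card (G ⧸ H) * Nat.card H := Subgroup.card_eq_card_quotient_mul_card_subgroup H
  rw [Nat.card_eq_fintype_card, Nat.card_eq_fintype_card, hHcard, hcard] at hGP
  have hn : Fintype.card (G ⧸ H) = n := by
    have : (2 * p) * Fintype.card (G ⧸ H) = (2 * p) * n := by rw [mul_comm (2 * p) (Fintype.card _)]; exact hGP.symm
    exact Nat.eq_of_mul_eq_mul_left (by omega) this
  set rep : G ⧸ H → G := Quotient.out with hrepdef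
  have hrep : ∀ q : G ⧸ H, ((rep q : G) : G ⧸ H) = q := fun q => Quotient.out_eq q
  have hcoe : ∀ y w : G, w ∈ H → ((y * w : G) : G ⧸ H) = (y : G ⧸ H) := fun y w hw =>
    (QuotientGroup.eq.2 (by rw [inv_mul_cancel_left]; exact hw)).symm
  have hrepH : ∀ x : G, (rep (x : G ⧸ H))⁻¹ * x ∈ H := fun x => QuotientGroup.eq.1 (hrep _)
  have hsmulcoe : ∀ (g' : G) (q : G ⧸ H), ((g' * rep q : G) : G ⧸ H) = g' • q := fun g' q => by
    rw [← smul_eq_mul, ← MulAction.Quotient.smul_coe, hrep]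
  -- §3.4 the «upper» predicate
  set χ : G → Bool := fun w => decide (∃ j < p, w = c * u ^ j) with hχ
  have hχpow : ∀ j, χ (u ^ j) = false := fun j => by
    simp only [hχ, decide_eq_false_iff_not, not_exists, not_and]
    exact fun i _ h => hexcl j i h
  have hχcpow : ∀ j, χ (c * u ^ j) = true := fun j => by
    simp only [hχ, decide_eq_true_eq]
    exact ⟨j % p, Nat.mod_lt _ hpos, by rw [hmod]⟩
  have hχu : ∀ w, w ∈ H → χ (w * u) = χ w := by
    intro w hw
    obtain ⟨j, -, rfl | rfl⟩ := (hH w).1 hw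
    · rw [← pow_succ, hχpow, hχpow]
    · rw [mul_assoc, ← pow_succ, hχcpow, hχcpow]
  have hχc : ∀ w, w ∈ H → χ (w * c) = !χ w := by
    intro w hw
    obtain ⟨j, -, rfl | rfl⟩ := (hH w).1 hw
    · rw [← hcomm, hχcpow, hχpow]; rfl
    · rw [mul_assoc, ← hcomm, ← mul_assoc, hcc, one_mul, hχpow, hχcpow]; rfl
  have hχ1 : χ 1 = false := by rw [← pow_zero u]; exact hχpow 0
  set up : G → Bool := fun x => χ ((rep (x : G ⧸ H))⁻¹ * x) with hup'
  have hupmul : ∀ y w : G, w ∈ H → up (y * w) = χ ((rep (y : G ⧸ H))⁻¹ * y * w) := by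
    intro y w hw; simp only [hup']; rw [hcoe y w hw, ← mul_assoc]
  have hupu : ∀ y : G, up (y * u) = up y := fun y => by rw [hupmul y u huH, hχu _ (hrepH y)]
  have hupc : ∀ y : G, up (y * c) = !up y := fun y => by rw [hupmul y c hcH, hχc _ (hrepH y)]
  have huprep : ∀ q : G ⧸ H, up (rep q) = false := by
    intro q
    have e : rep ((rep q : G) : G ⧸ H) = rep q := by rw [hrep]
    simp only [hup', e, inv_mul_cancel]; exact hχ1
  -- §3.5 the section sets: right `u`-invariance, CM, and the twisted system of a left stabiliser
  have hT : ∀ (ε : G ⧸ H → Bool) (x : G), x ∈ (Finset.univ.filter fun y : G => up y = ε (y : G ⧸ H)) ↔ up x = ε x :=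
    fun ε x => by rw [Finset.mem_filter, and_iff_right (Finset.mem_univ x)]
  have hTu : ∀ (ε : G ⧸ H → Bool) (x : G), x * u ∈ (Finset.univ.filter fun y : G => up y = ε (y : G ⧸ H)) ↔
      x ∈ (Finset.univ.filter fun y : G => up y = ε (y : G ⧸ H)) := by
    intro ε x; rw [hT, hT, hupu, hcoe x u huH]
  have hTc : ∀ (ε : G ⧸ H → Bool) (x : G), x ∈ (Finset.univ.filter fun y : G => up y = ε (y : G ⧸ H)) ↔
      c * x ∉ (Finset.univ.filter fun y : G => up y = ε (y : G ⧸ H)) := by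
    intro ε x
    rw [hT, hT, hcen x, hupc, hcoe x c hcH]
    cases up x <;> cases ε (x : G ⧸ H) <;> simp
  have hstab : ∀ (ε : G ⧸ H → Bool) (v : G),
      (∀ x, x ∈ (Finset.univ.filter fun y : G => up y = ε (y : G ⧸ H)) ↔
        v * x ∈ (Finset.univ.filter fun y : G => up y = ε (y : G ⧸ H))) →
      ∀ q : G ⧸ H, ε (v • q) = xor (ε q) (up (v * rep q)) := by
    intro ε v hv q
    have h1 := hv (rep q)
    rw [hT, hT, huprep, hrep, hsmulcoe] at h1
    have h2 := hv (rep q * c)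
    rw [hT, hT, hupc, huprep, hcoe _ c hcH, hrep, ← mul_assoc, hupc, hcoe _ c hcH, hsmulcoe] at h2
    revert h1 h2
    cases ε q <;> cases ε (v • q) <;> cases up (v * rep q) <;> simp
  -- §3.6 conjugate power sets `K a = {a u^i a⁻¹ : i < p}`
  set K : G → Finset G := fun a => (Finset.range p).image (fun i => a * u ^ i * a⁻¹) with hKdef
  have hKw : ∀ a w : G, w ∈ H → K (a * w) = K a := by
    intro a w hw
    simp only [hKdef]
    refine Finset.image_congr fun i _ => ?_
    calc a * w * u ^ i * (a * w)⁻¹ = a * (w * u ^ i * w⁻¹) * a⁻¹ := by group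
      _ = a * u ^ i * a⁻¹ := by rw [hHu w hw i]
  have hKconj : ∀ g' a : G, K (g' * a) = (K a).image (fun x => g' * x * g'⁻¹) := by
    intro g' a
    simp only [hKdef, Finset.image_image]
    refine Finset.image_congr fun i _ => ?_
    simp only [Function.comp_apply]; group
  have hone_mem : ∀ a : G, (1 : G) ∈ K a := fun a =>
    Finset.mem_image.2 ⟨0, Finset.mem_range.2 hpos, by rw [pow_zero, mul_one, mul_inv_cancel]⟩
  have hKcard : ∀ a : G, ((K a).erase 1).card ≤ p - 1 := fun a => by
    rw [Finset.card_erase_of_mem (hone_mem a)]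
    exact Nat.sub_le_sub_right (Finset.card_image_le.trans (by rw [Finset.card_range])) 1
  have hKeq : ∀ (a b v : G), v ≠ 1 → v ∈ K a → v ∈ K b → K a = K b := fun a b v hv1 ha hb => by
    simp only [hKdef] at ha hb ⊢
    exact (image_conj_pow_eq_of_mem hord hv1 ha).trans (image_conj_pow_eq_of_mem hord hv1 hb).symm
  -- the equivariant map `q ↦ K (rep q)` and its fibres
  have hrepsmul : ∀ (g' : G) (q : G ⧸ H), ∃ w ∈ H, rep (g' • q) = g' * rep q * w := by
    intro g' q
    refine ⟨(g' * rep q)⁻¹ * rep (g' • q), QuotientGroup.eq.1 (by rw [hsmulcoe, hrep]), ?_⟩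
    rw [mul_inv_cancel_left]
  have hKsmul : ∀ (g' : G) (q : G ⧸ H), K (rep (g' • q)) = (K (rep q)).image (fun x => g' * x * g'⁻¹) := by
    intro g' q
    obtain ⟨w, hw, e⟩ := hrepsmul g' q
    rw [e, hKw _ w hw, hKconj]
  have hfib : ∀ q₁ q₂ : G ⧸ H, (Finset.univ.filter fun q : G ⧸ H => K (rep q) = K (rep q₁)).card ≤
      (Finset.univ.filter fun q : G ⧸ H => K (rep q) = K (rep q₂)).card := by
    intro q₁ q₂
    set g' : G := rep q₂ * (rep q₁)⁻¹ with hg'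
    have e2 : K (rep q₂) = (K (rep q₁)).image (fun x => g' * x * g'⁻¹) := by
      rw [← hKconj, hg', inv_mul_cancel_right]
    refine Finset.card_le_card_of_injOn (fun q => g' • q) (fun q hq => ?_) fun q₃ _ q₄ _ h => MulAction.injective g' h
    rw [Finset.mem_coe, Finset.mem_filter] at hq ⊢
    exact ⟨Finset.mem_univ _, by rw [hKsmul, hq.2, e2]⟩
  set s : ℕ := (Finset.univ.filter fun q : G ⧸ H => K (rep q) = K (rep (((1 : G) : G ⧸ H)))).card with hsdef
  have hfibs : ∀ q₁ : G ⧸ H, (Finset.univ.filter fun q : G ⧸ H => K (rep q) = K (rep q₁)).card = s :=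
    fun q₁ => le_antisymm (hfib _ _) (hfib _ _)
  set 𝒦 : Finset (Finset G) := Finset.univ.image (fun q : G ⧸ H => K (rep q)) with h𝒦def
  set m : ℕ := 𝒦.card with hmdef
  have hms : n = m * s := by
    rw [← hn, ← Finset.card_univ, Finset.card_eq_sum_card_fiberwise (f := fun q : G ⧸ H => K (rep q))
      (t := 𝒦) (fun q _ => Finset.mem_image_of_mem _ (Finset.mem_univ q)), hmdef, ← smul_eq_mul, ← Finset.sum_const]
    refine Finset.sum_congr rfl fun Kq hKq => ?_
    obtain ⟨q₁, -, rfl⟩ := Finset.mem_image.1 hKq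
    exact hfibs q₁
  -- `m ≥ m₀`: the conjugates by the family `g` are pairwise distinct
  have hKg : ∀ i : Fin m₀, K (rep ((g i : G) : G ⧸ H)) = K (g i) := by
    intro i
    have hw := hrepH (g i)
    have e : rep ((g i : G) : G ⧸ H) = g i * ((rep ((g i : G) : G ⧸ H))⁻¹ * g i)⁻¹ := by
      rw [mul_inv_rev, inv_inv, mul_inv_cancel_left]
    rw [e, hKw _ _ (inv_mem hw)]
  have hm₀ : m₀ ≤ m := by
    have h := Finset.card_le_card_of_injOn (s := (Finset.univ : Finset (Fin m₀))) (t := 𝒦) (fun i => K (g i))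
      (fun i _ => by
        rw [Finset.mem_coe, h𝒦def, Finset.mem_image]
        exact ⟨((g i : G) : G ⧸ H), Finset.mem_univ _, hKg i⟩)
      (by
        intro i _ j _ hij
        by_contra hne
        -- from `K (g i) = K (g j)`: `(g j)⁻¹ g i` and `(g i)⁻¹ g j` conjugate `u` into `⟨u⟩`
        have key : ∀ i j : Fin m₀, K (g i) = K (g j) → ∃ k < p, ((g j)⁻¹ * g i) * u * ((g j)⁻¹ * g i)⁻¹ = u ^ k := by
          intro i j hK
          have hmem : g i * u ^ 1 * (g i)⁻¹ ∈ K (g j) := by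
            rw [← hK]; exact Finset.mem_image.2 ⟨1, Finset.mem_range.2 hp.out.one_lt, rfl⟩
          obtain ⟨k, hk, hk'⟩ := Finset.mem_image.1 hmem
          refine ⟨k, Finset.mem_range.1 hk, ?_⟩
          rw [pow_one] at hk'
          calc (g j)⁻¹ * g i * u * ((g j)⁻¹ * g i)⁻¹ = (g j)⁻¹ * (g i * u * (g i)⁻¹) * g j := by group
            _ = u ^ k := by rw [← hk']; group
        rcases lt_or_gt_of_ne hne with hlt | hlt
        · obtain ⟨k, hk, hk'⟩ := key i j hij
          exact hind i j hlt k hk hk'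
        · obtain ⟨k, hk, hk'⟩ := key j i hij.symm
          exact hind j i hlt k hk hk')
    rwa [Finset.card_univ, Fintype.card_fin] at h
  have hmpos : 0 < m := by
    rw [hmdef]; exact Finset.card_pos.2 ⟨_, Finset.mem_image_of_mem _ (Finset.mem_univ (((1 : G) : G ⧸ H)))⟩
  have hsdiv : m ∣ n := ⟨s, hms⟩
  have hsn : s = n / m := by rw [hms, Nat.mul_div_cancel_left _ hmpos]
  -- §3.7 fixed points with trivial twist lie in one fibre
  have hfix : ∀ (v : G), v ≠ 1 → ∀ q : G ⧸ H, v • q = q → up (v * rep q) = false → v ∈ K (rep q) := by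
    intro v hv q hq hupv
    have hw : (rep q)⁻¹ * (v * rep q) ∈ H := by
      have := hrepH (v * rep q); rwa [hsmulcoe, hq] at this
    have hup2 : up (v * rep q) = χ ((rep q)⁻¹ * (v * rep q)) := by simp only [hup', hsmulcoe, hq]
    rw [hup2] at hupv
    obtain ⟨j, hj, h | h⟩ := (hH _).1 hw
    · refine Finset.mem_image.2 ⟨j, Finset.mem_range.2 hj, ?_⟩
      rw [← h]; group
    · rw [h, hχcpow] at hupv; exact absurd hupv (by decide)
  set V := (Finset.univ : Finset G).erase 1 with hVdef
  set V₁ := V.filter (fun v => ∃ q : G ⧸ H, v ∈ K (rep q)) with hV₁def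
  have hFix1 : ∀ v ∈ V₁, (Finset.univ.filter fun q : G ⧸ H => v • q = q ∧ up (v * rep q) = false).card ≤ s := by
    intro v hv
    obtain ⟨hvV, q₀, hq₀⟩ := Finset.mem_filter.1 hv
    have hv1 : v ≠ 1 := (Finset.mem_erase.1 hvV).1
    rw [← hfibs q₀]
    refine Finset.card_le_card fun q hq => ?_
    rw [Finset.mem_filter] at hq ⊢
    exact ⟨Finset.mem_univ _, hKeq _ _ v hv1 (hfix v hv1 q hq.2.1 hq.2.2) hq₀⟩
  have hFix0 : ∀ v ∈ V, v ∉ V₁ → (Finset.univ.filter fun q : G ⧸ H => v • q = q ∧ up (v * rep q) = false).card = 0 := by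
    intro v hv hv₁
    rw [Finset.card_eq_zero, Finset.filter_eq_empty_iff]
    intro q _ hq
    exact hv₁ (Finset.mem_filter.2 ⟨hv, q, hfix v (Finset.mem_erase.1 hv).1 q hq.1 hq.2⟩)
  -- §3.8' the refined count: `|V₁| = m(p-1)` exactly, and each `v ∈ V₁` acts on `P` with cycles of length `p`
  have hKcard' : ∀ a : G, (K a).card = p := by
    intro a
    rw [hKdef, Finset.card_image_of_injOn, Finset.card_range]
    intro i hi j hj hij
    simp only [Finset.coe_range, Set.mem_Iio] at hi hj
    have hij' : u ^ i = u ^ j := by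
      have := congrArg (fun y => a⁻¹ * y * a) hij
      simpa [mul_assoc] using this
    exact pow_injOn_Iio_orderOf (by rw [Set.mem_Iio, hord]; exact hi) (by rw [Set.mem_Iio, hord]; exact hj) hij'
  have hV₁eq : V₁ = 𝒦.biUnion fun Kq => Kq.erase 1 := by
    refine Finset.Subset.antisymm ?_ ?_
    · intro v hv
      obtain ⟨hvV, q₀, hq₀⟩ := Finset.mem_filter.1 hv
      exact Finset.mem_biUnion.2 ⟨K (rep q₀), Finset.mem_image_of_mem _ (Finset.mem_univ _),
        Finset.mem_erase.2 ⟨(Finset.mem_erase.1 hvV).1, hq₀⟩⟩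
    · intro v hv
      obtain ⟨Kq, hKq, hvK⟩ := Finset.mem_biUnion.1 hv
      obtain ⟨q₁, -, rfl⟩ := Finset.mem_image.1 hKq
      obtain ⟨hv1, hvK'⟩ := Finset.mem_erase.1 hvK
      exact Finset.mem_filter.2 ⟨Finset.mem_erase.2 ⟨hv1, Finset.mem_univ v⟩, q₁, hvK'⟩
  have hV₁card : V₁.card = m * (p - 1) := by
    rw [hV₁eq, Finset.card_biUnion]
    · rw [hmdef, ← smul_eq_mul, ← Finset.sum_const]
      refine Finset.sum_congr rfl fun Kq hKq => ?_
      obtain ⟨q₁, -, rfl⟩ := Finset.mem_image.1 hKq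
      rw [Finset.card_erase_of_mem (hone_mem _), hKcard']
    · intro K₁ hK₁ K₂ hK₂ hne
      obtain ⟨q₁, -, rfl⟩ := Finset.mem_image.1 hK₁
      obtain ⟨q₂, -, rfl⟩ := Finset.mem_image.1 hK₂
      rw [Function.onFun, Finset.disjoint_left]
      intro v hv₁ hv₂
      obtain ⟨hv1, hv₁'⟩ := Finset.mem_erase.1 hv₁
      obtain ⟨-, hv₂'⟩ := Finset.mem_erase.1 hv₂
      exact hne (hKeq _ _ v hv1 hv₁' hv₂')
  have hV₁sub : V₁ ⊆ V := Finset.filter_subset _ V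
  have hVcard : V.card = Fintype.card G - 1 := by
    rw [hVdef, Finset.card_erase_of_mem (Finset.mem_univ _), Finset.card_univ]
  -- orders in `V₁`
  have hV₁pow : ∀ v ∈ V₁, v ^ p = 1 := by
    intro v hv
    obtain ⟨-, q₀, hq₀⟩ := Finset.mem_filter.1 hv
    obtain ⟨i, -, rfl⟩ := Finset.mem_image.1 hq₀
    rw [conj_pow, ← pow_mul, mul_comm, pow_mul, hup, one_pow, mul_one, mul_inv_cancel]
  have hV₁cyc : ∀ v ∈ V₁, ∀ q : G ⧸ H, v • q ≠ q → ∀ j, 0 < j → j < p → (fun q' : G ⧸ H => v • q')^[j] q ≠ q := by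
    intro v hv q hq j hj hjp h
    rw [smul_iterate] at h
    exact hq (smul_eq_self_of_pow_smul_eq_self hp.out (hV₁pow v hv) hj hjp h)
  -- per-element bounds
  set B : G → ℕ := fun v => if v ∈ V₁ then 2 ^ ((n + (p - 1) * (n / m)) / p) else 2 ^ (n / 2) with hBdef
  have hB : ∀ v ∈ V, (Finset.univ.filter fun ε : G ⧸ H → Bool =>
      ∀ q, ε (v • q) = xor (ε q) (up (v * rep q))).card ≤ B v := by
    intro v hv
    by_cases hv₁ : v ∈ V₁
    · rw [hBdef]; simp only [hv₁, if_true]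
      refine (SectionCount.card_filter_twisted_le_cycle (fun q : G ⧸ H => v • q) (MulAction.injective v)
        (fun q => up (v * rep q)) p hp.out.pos (hV₁cyc v hv₁)).trans (Nat.pow_le_pow_right two_pos ?_)
      rw [hn]
      have h1 := hFix1 v hv₁
      rw [hsn] at h1
      exact Nat.div_le_div_right (Nat.add_le_add_left (Nat.mul_le_mul_left _ h1) _)
    · rw [hBdef]; simp only [hv₁, if_false]
      refine (SectionCount.card_filter_twisted_le_fix (fun q : G ⧸ H => v • q) (MulAction.injective v)
        (fun q => up (v * rep q))).trans (le_of_eq ?_)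
      rw [hn, hFix0 v hv hv₁, Nat.add_zero]
  have hbig : ∑ v ∈ V, B v < 2 ^ Fintype.card (G ⧸ H) := by
    rw [hn, ← Finset.sum_filter_add_sum_filter_not V (fun v => v ∈ V₁)]
    have hf1 : V.filter (fun v => v ∈ V₁) = V₁ := by
      ext v; simp only [Finset.mem_filter]; exact ⟨fun h => h.2, fun h => ⟨hV₁sub h, h⟩⟩
    have hf2 : (V.filter (fun v => ¬ v ∈ V₁)).card = Fintype.card G - 1 - m * (p - 1) := by
      have := Finset.card_filter_add_card_filter_not (s := V) (fun v => v ∈ V₁)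
      rw [hf1, hV₁card, hVcard] at this
      omega
    have h1 : ∑ v ∈ V.filter (fun v => v ∈ V₁), B v = m * (p - 1) * 2 ^ ((n + (p - 1) * (n / m)) / p) := by
      rw [hf1]
      calc ∑ v ∈ V₁, B v = ∑ _v ∈ V₁, 2 ^ ((n + (p - 1) * (n / m)) / p) :=
            Finset.sum_congr rfl fun v hv => by simp only [hBdef, hv, if_true]
        _ = _ := by rw [Finset.sum_const, smul_eq_mul, hV₁card]
    have h2 : ∑ v ∈ V.filter (fun v => ¬ v ∈ V₁), B v = (Fintype.card G - 1 - m * (p - 1)) * 2 ^ (n / 2) := by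
      calc ∑ v ∈ V.filter (fun v => ¬ v ∈ V₁), B v = ∑ _v ∈ V.filter (fun v => ¬ v ∈ V₁), 2 ^ (n / 2) :=
            Finset.sum_congr rfl fun v hv => by simp only [hBdef, (Finset.mem_filter.1 hv).2, if_false]
        _ = _ := by rw [Finset.sum_const, smul_eq_mul, hf2]
    rw [h1, h2]
    have := hcount m hm₀ hsdiv
    omega
  -- §3.9 a section violating every system
  obtain ⟨ε, hε⟩ := SectionCount.exists_forall_violated_of_le V
    (fun v (q : G ⧸ H) => v • q) (fun v q => up (v * rep q)) B hB hbig
  refine ⟨Finset.univ.filter fun y : G => up y = ε (y : G ⧸ H), hTc ε, fun v hv => ?_, hTu ε⟩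
  by_contra hcon
  have hcon' : ∀ x, x ∈ (Finset.univ.filter fun y : G => up y = ε (y : G ⧸ H)) ↔
      v * x ∈ (Finset.univ.filter fun y : G => up y = ε (y : G ⧸ H)) := fun x => by
    by_contra h; exact hcon ⟨x, h⟩
  obtain ⟨q, hq⟩ := hε v (by rw [hVdef]; exact Finset.mem_erase.2 ⟨hv, Finset.mem_univ v⟩)
  exact hq (hstab ε v hcon' q)

/-- **A NON-NORMAL SUBGROUP OF PRIME ORDER YIELDS A SKEW CM SET** (REFINED count).  `c ≠ 1` a central involution, `u` of prime order
`p`, `⟨u⟩` NOT normal (`g u g⁻¹ ∉ ⟨u⟩` for some `g`), `|G| = 2pn`, and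
`(|G| - 1 - m(p-1))·2^(n/2) + m(p-1)·2^((n + (p-1)(n/m))/p) < 2^n` for every `m ≥ 2` dividing `n` ⟹ some `T ⊆ G` has
`x ∈ T ↔ cx ∉ T`, trivial left stabiliser and `T u = T`. [folklore] -/
theorem exists_skew_of_nonnormal_prime_order' (c u : G) (p n : ℕ) [hp : Fact p.Prime]
    (hcc : c * c = 1) (hc1 : c ≠ 1) (hcen : ∀ g : G, c * g = g * c) (hup : u ^ p = 1) (hu1 : u ≠ 1)
    (hcard : Fintype.card G = 2 * p * n) (hnn : ∃ g : G, ∀ k < p, g * u * g⁻¹ ≠ u ^ k)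
    (hcount : ∀ m, 2 ≤ m → m ∣ n →
      (Fintype.card G - 1 - m * (p - 1)) * 2 ^ (n / 2) + m * (p - 1) * 2 ^ ((n + (p - 1) * (n / m)) / p) < 2 ^ n) :
    ∃ T : Finset G, (∀ x, x ∈ T ↔ c * x ∉ T) ∧ (∀ v : G, v ≠ 1 → ∃ w, ¬ (w ∈ T ↔ v * w ∈ T)) ∧
      (∀ x, x * u ∈ T ↔ x ∈ T) := by
  have hcU := ne_pow_of_nonnormal hc1 hcen hup hu1 hnn
  obtain ⟨g₀, hg₀⟩ := hnn
  refine exists_skew_of_prime_order_family' c u p n 2 hcc hcen hup hu1 hcU hcard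
    (fun i => if (i : ℕ) = 0 then 1 else g₀⁻¹) ?_ hcount
  intro i j hij k hk
  fin_cases i <;> fin_cases j
  · exact absurd hij (lt_irrefl _)
  · simpa using hg₀ k hk
  · exact absurd hij (by decide)
  · exact absurd hij (lt_irrefl _)

end Summit.HodgeConjecture.CorCM.GaloisModels.SkewSectionPrime
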